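import Literature.Probability.RandomPlanarGeometry.SAWPulledRenewalGap
import Literature.Probability.RandomPlanarGeometry.SAWPulledSpanEnvelope
import Literature.Probability.RandomPlanarGeometry.SAWPulledFreeEnergyZ2SharpTilts
import Literature.Probability.RandomPlanarGeometry.SAWFiniteMemory18At2688
import HarnessLib

/-!
# The pulled renewal gap on `ℤ²`: COMPUTATIONAL editions (the `2.688` gap condition; tilts `2, 125/64, 25/16, 3/2`)

Topic `Literature/Probability/RandomPlanarGeometry`, continuing `SAWPulledRenewalGap.lean` (standard-axiom ladder editions,
instances `y ∈ {256/81, 3, 4}` with `U = 3`). Here the sharper bound `μ(ℤ²) ≤ 2.688` (`SAW.connectiveConstant_le_2688`,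
the declared `K = 18` finite-memory `native_decide` certificate) and the certified tilt windows of
`SAWPulledFreeEnergyZ2Tilts.lean` / `SAWPulledFreeEnergyZ2SharpTilts.lean` (declared `checkW` / strip `dpAt` certificates)
are plugged in; every theorem of this file therefore carries declared computational axioms BY DESIGN (lane «pcv-sawmu»,
route R35; the numbers were signed on the lane's census before filing: rows P-R35-3 / P-R35-3♯).

## Contents (namespace `…SAW.Zd`)

* the planner's literal shapes (a-idea-1 `Sketch_G8_PullGap.lean`, stubs `stub_R35_4_pulledKesten` /
  `stub_R35_5_mean_summable`): `gapRatio_lt_one`, `inv_le_gapRatio`, `pulledBlockLaw_le_geometric`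
  (`p_i(y) ≤ (y^{2/3} + 2y)·(2.688 y^{1/3}/L)^i`, from a-p4's plain envelope `Zd.pulledIrrZ₂_mul_exp_le`),
  **`hasSum_pulledBlockLaw`** / **`summable_mul_pulledBlockLaw`** under `2.688³·y < L³`, the `ℤ²` gap forms
  `two_sub_pulledMeanBlock_le_pulledAmp`, `tendsto_pulledAmp`, `pulledBridgeZ_sandwich`, `abs_pulledAmp_sub_inv_le`,
  `pulledGap_of_gap`;
* instances: `pulledGap_two` (`L = 1250/351`), `pulledGap_r125_64` (`L = 10⁴/2850`) via the `2.688` condition;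
  `pulledBridgeFreeEnergy_elevenNinths_le` and the rung-`11/9` ladder editions `pulledGap_r25_16` (span-1 `L = 10⁴/3257`),
  `pulledGap_threeHalves` (strip `L = 10⁴/3251`) — at `y = 3/2` the plain condition fails with every window in the tree
  (`q(3/2) = 1.0004`), the ladder condition holds (`33.35 < 35.57`).

Sources as in `SAWPulledRenewalGap.lean` (Madras–Slade 1993 §4.2, (4.2.15)–(4.2.16), (4.2.21)–(4.2.22), Thm 4.2.2 (b),
Thm 4.2.5, App. B (B.5); Beaton 2015 Lemma 2).
-/

noncomputable section

open Finset Filter Topology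
open scoped BigOperators
open Literature.Probability.LatticeModels
open Literature.Probability.RandomPlanarGeometry.SAW

namespace Literature.Probability.RandomPlanarGeometry.SAW.Zd

/-! ### The planner's literal gap condition `2.688³·y < L³` -/

/-- `e^{-iλ} ≤ (L^i)⁻¹` when `log L ≤ λ` and `L > 0`. [folklore] -/
private theorem exp_neg_mul_le_inv_pow_of_log_le'' {L lam : ℝ} (hL : 0 < L) (hLB : Real.log L ≤ lam) (i : ℕ) :
    Real.exp (-(i : ℝ) * lam) ≤ (L ^ i)⁻¹ := by
  have h1 : L ^ i ≤ Real.exp ((i : ℝ) * lam) := by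
    calc L ^ i = Real.exp (Real.log L) ^ i := by rw [Real.exp_log hL]
      _ = Real.exp ((i : ℝ) * Real.log L) := by rw [← Real.exp_nat_mul]
      _ ≤ Real.exp ((i : ℝ) * lam) := Real.exp_le_exp.2 (mul_le_mul_of_nonneg_left hLB (Nat.cast_nonneg _))
  rw [show -(i : ℝ) * lam = -((i : ℝ) * lam) by ring, Real.exp_neg]
  exact inv_anti₀ (pow_pos hL i) h1

/-- The gap ratio `q(y, L) = 2.688·y^{1/3}/L` is `< 1` exactly when `2.688³·y < L³` (cube-root-free form of the
gap condition; `y ≥ 0`, `L > 0`). [cite: MadrasSlade1993, §4.2, (4.2.22)] -/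
theorem gapRatio_lt_one {y L : ℝ} (hy : 0 ≤ y) (hL : 0 < L) (hq : (2.688 : ℝ) ^ 3 * y < L ^ 3) :
    2.688 * y ^ (1 / 3 : ℝ) / L < 1 := by
  rw [div_lt_one hL]
  by_contra h
  rw [not_lt] at h
  have hcube : (y ^ (1 / 3 : ℝ)) ^ 3 = y := by
    rw [← Real.rpow_natCast (y ^ (1 / 3 : ℝ)) 3, ← Real.rpow_mul hy]; norm_num
  have h4 : L ^ 3 ≤ (2.688 * y ^ (1 / 3 : ℝ)) ^ 3 := pow_le_pow_left₀ hL.le h 3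
  rw [mul_pow, hcube] at h4
  linarith

/-- `L⁻¹ ≤ q(y, L)` for `y ≥ 1` (the span-1 decay rate `1/L` is dominated by the gap ratio). [cite: MadrasSlade1993, §4.2, (4.2.22)] -/
theorem inv_le_gapRatio {y L : ℝ} (hy : 1 ≤ y) (hL : 0 < L) : L⁻¹ ≤ 2.688 * y ^ (1 / 3 : ℝ) / L := by
  rw [inv_eq_one_div]
  refine div_le_div_of_nonneg_right ?_ hL.le
  have hy3 : 1 ≤ y ^ (1 / 3 : ℝ) := Real.one_le_rpow hy (by norm_num)
  nlinarith

/-- **Geometric envelope of the pulled block law.** For `y ≥ 1`, `L > 0` with `log L ≤ λ_B(y)`: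
`p_i(y) ≤ (y^{2/3} + 2y) · q^i` for EVERY `i`, `q = 2.688·y^{1/3}/L` (span `≥ 2`: three-crossings envelope
R35.3; span `1`: `2y·L^{-i} ≤ 2y·q^i`). [cite: MadrasSlade1993, (4.2.21)–(4.2.22)] -/
theorem pulledBlockLaw_le_geometric {y L : ℝ} (hy : 1 ≤ y) (hL : 0 < L)
    (hLB : Real.log L ≤ pulledBridgeFreeEnergy 2 y) (i : ℕ) :
    pulledBlockLaw 2 y i ≤ (y ^ (2 / 3 : ℝ) + 2 * y) * (2.688 * y ^ (1 / 3 : ℝ) / L) ^ i := by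
  have hy0 : 0 ≤ y := by linarith
  set q : ℝ := 2.688 * y ^ (1 / 3 : ℝ) / L with hqdef
  have hq0 : 0 ≤ q := by rw [hqdef]; positivity
  rcases Nat.eq_zero_or_pos i with rfl | hi
  · rw [pulledBlockLaw_zero y, pow_zero, mul_one]
    positivity
  · set E := Real.exp (-(i : ℝ) * pulledBridgeFreeEnergy 2 y) with hE
    have hE0 : 0 ≤ E := (Real.exp_pos _).le
    have h2 := pulledIrrZ₂_mul_exp_le i hy hL hLB
    have hEL : E ≤ (L ^ i)⁻¹ := exp_neg_mul_le_inv_pow_of_log_le'' hL hLB i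
    have hLq : (L ^ i)⁻¹ ≤ q ^ i := by
      rw [← inv_pow]
      exact pow_le_pow_left₀ (inv_nonneg.2 hL.le) (inv_le_gapRatio hy hL) i
    have hsplit := pulledIrrZ_le_pulledIrrZ₂_add i hi hy0
    unfold pulledBlockLaw
    calc pulledIrrZ 2 i y * E ≤ (pulledIrrZ₂ 2 i y + 2 * y) * E := mul_le_mul_of_nonneg_right hsplit hE0
      _ = pulledIrrZ₂ 2 i y * E + 2 * y * E := by ring
      _ ≤ y ^ (2 / 3 : ℝ) * q ^ i + 2 * y * q ^ i :=
          add_le_add h2 (mul_le_mul_of_nonneg_left (hEL.trans hLq) (by linarith))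
      _ = (y ^ (2 / 3 : ℝ) + 2 * y) * q ^ i := by ring

/-! ### R35.4 / R35.5: pulled Kesten relation and finite mean under the gap condition -/

/-- **R35.4 — pulled Kesten relation where the gap holds.** On `ℤ²`, for `y ≥ 1` and any certified window
`log L ≤ λ_B(y)` with `2.688³·y < L³`: `Σ_i Λ_i(y) e^{-iλ_B(y)} = 1`. Elementary: geometric envelope
(`pulledBlockLaw_le_geometric`) + exponential sharpness of the Fekete normalisation
(`pulledAmp_mul_pow_unbounded`) fed to `Renewal.hasSum_f_one_of_envelope`. Printed for all `y ≥ 1` without the gap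
by generating-function analysis: Beaton 2015 Lemma 2 (`I(e^{-λ(y)}, y) = 1`) via Madras–Slade (4.2.15).
[cite: Beaton2015, Lemma 2; MadrasSlade1993, (4.2.15)] -/
theorem hasSum_pulledBlockLaw {y L : ℝ} (hy : 1 ≤ y) (hL : 0 < L)
    (hLB : Real.log L ≤ pulledBridgeFreeEnergy 2 y) (hq : (2.688 : ℝ) ^ 3 * y < L ^ 3) :
    HasSum (pulledBlockLaw 2 y) 1 := by
  have hy0 : 0 < y := by linarith
  have hq1 := gapRatio_lt_one hy0.le hL hq
  have hq0 : 0 < 2.688 * y ^ (1 / 3 : ℝ) / L := lt_of_lt_of_le (inv_pos.2 hL) (inv_le_gapRatio hy hL)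
  exact Literature.Probability.Process.Renewal.hasSum_f_one_of_envelope (pulledAmp_zero 1 y)
    (pulledAmp_nonneg 1 hy0) (pulledAmp_le_one 1 hy0) (pulledBlockLaw_nonneg hy0.le) (pulledBlockLaw_zero y)
    (fun n hn => pulledAmp_renewal 1 y n hn) hq0 hq1 (pulledBlockLaw_le_geometric hy hL hLB)
    (fun s hs M => pulledAmp_mul_pow_unbounded 1 hy0 hs M)

/-- **R35.5 — the mean block length is finite under the gap condition**: `Σ_i i·p_i(y) < ∞`.
[cite: MadrasSlade1993, Theorem 4.2.2 (b); Beaton2015, Lemma 2] -/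
theorem summable_mul_pulledBlockLaw {y L : ℝ} (hy : 1 ≤ y) (hL : 0 < L)
    (hLB : Real.log L ≤ pulledBridgeFreeEnergy 2 y) (hq : (2.688 : ℝ) ^ 3 * y < L ^ 3) :
    Summable fun i : ℕ => (i : ℝ) * pulledBlockLaw 2 y i := by
  have hy0 : 0 < y := by linarith
  have hq1 := gapRatio_lt_one hy0.le hL hq
  have hq0 : 0 < 2.688 * y ^ (1 / 3 : ℝ) / L := lt_of_lt_of_le (inv_pos.2 hL) (inv_le_gapRatio hy hL)
  exact Literature.Probability.Process.Renewal.summable_mul_f_of_envelope (pulledBlockLaw_nonneg hy0.le) hq0 hq1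
    (pulledBlockLaw_le_geometric hy hL hLB)

/-! ### The `ℤ²` gap forms of the compositions -/

/-- **R35.7 on `ℤ²` (first half): all-`n` two-sided amplitude bound under the gap condition**,
`2 - m(y) ≤ a_n(y) ≤ 1` for EVERY `n`, `m(y) = Σ_i i·p_i(y)` the mean block length. (Non-vacuous iff `m(y) < 2`;
certified e.g. at `y ∈ {256/81, 3, 4}` by census + tail data, not in this file.)
[cite: MadrasSlade1993, Appendix B, (B.5); IoffeVelenik2008, (3.31)–(3.33)] -/
theorem two_sub_pulledMeanBlock_le_pulledAmp {y L : ℝ} (hy : 1 ≤ y) (hL : 0 < L)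
    (hLB : Real.log L ≤ pulledBridgeFreeEnergy 2 y) (hq : (2.688 : ℝ) ^ 3 * y < L ^ 3) (n : ℕ) :
    2 - pulledMeanBlock 2 y ≤ pulledAmp 2 y n ∧ pulledAmp 2 y n ≤ 1 :=
  two_sub_pulledMeanBlock_le_pulledAmp_of 1 (by linarith) (hasSum_pulledBlockLaw hy hL hLB hq)
    (summable_mul_pulledBlockLaw hy hL hLB hq) n

/-- **R35.7 on `ℤ²` (second half): Ornstein–Zernike limit under the gap condition**, `a_n(y) → 1/m(y)`, i.e.
`Z^B_n(y) e^{-nλ_B(y)} → 1/m(y)`. Printed qualitatively: Madras–Slade Theorem 4.2.2 (b) / (4.2.16); Ioffe–Velenik 2008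
(3.9)–(3.10). [cite: MadrasSlade1993, Theorem 4.2.2 (b) and (4.2.16)] -/
theorem tendsto_pulledAmp {y L : ℝ} (hy : 1 ≤ y) (hL : 0 < L)
    (hLB : Real.log L ≤ pulledBridgeFreeEnergy 2 y) (hq : (2.688 : ℝ) ^ 3 * y < L ^ 3) :
    Tendsto (pulledAmp 2 y) atTop (𝓝 (pulledMeanBlock 2 y)⁻¹) :=
  tendsto_pulledAmp_of 1 (by linarith) (hasSum_pulledBlockLaw hy hL hLB hq) (summable_mul_pulledBlockLaw hy hL hLB hq)

/-- **The sandwich in partition-function form on `ℤ²`**: `(2 - m(y))·e^{nλ_B(y)} ≤ Z^B_n(y) ≤ e^{nλ_B(y)}` for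
every `n`, under the gap condition. [cite: MadrasSlade1993, Appendix B, (B.5); Beaton2015, §3] -/
theorem pulledBridgeZ_sandwich {y L : ℝ} (hy : 1 ≤ y) (hL : 0 < L)
    (hLB : Real.log L ≤ pulledBridgeFreeEnergy 2 y) (hq : (2.688 : ℝ) ^ 3 * y < L ^ 3) (n : ℕ) :
    (2 - pulledMeanBlock 2 y) * Real.exp ((n : ℝ) * pulledBridgeFreeEnergy 2 y) ≤ pulledBridgeZ 2 n y
    ∧ pulledBridgeZ 2 n y ≤ Real.exp ((n : ℝ) * pulledBridgeFreeEnergy 2 y) :=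
  pulledBridgeZ_sandwich_of 1 (by linarith) (hasSum_pulledBlockLaw hy hL hLB hq)
    (summable_mul_pulledBlockLaw hy hL hLB hq) n

/-- **R35.8 for pulled bridges on `ℤ²` — explicit exponential Ornstein–Zernike rate under the gap condition**:
for any `r ≥ 1` and any certified values `G < 1`, `H` of the two tail series of the block law,
`|a_n(y) - 1/m(y)| ≤ H/(m(y)(1-G)) · r^{-n}` for EVERY `n`. The inexplicit printed counterpart is Madras–Slade
Theorem 4.2.5 (`∃ ε(z) > 0`, residues). [cite: MadrasSlade1993, Theorem 4.2.5] -/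
theorem abs_pulledAmp_sub_inv_le {y L : ℝ} (hy : 1 ≤ y) (hL : 0 < L)
    (hLB : Real.log L ≤ pulledBridgeFreeEnergy 2 y) (hq : (2.688 : ℝ) ^ 3 * y < L ^ 3)
    {r G H : ℝ} (hr : 1 ≤ r)
    (hG : HasSum (fun j : ℕ => (1 - ∑ k ∈ range (j + 2), pulledBlockLaw 2 y k) * r ^ (j + 1)) G) (hG1 : G < 1)
    (hH : HasSum (fun j : ℕ => (1 - ∑ k ∈ range (j + 2), pulledBlockLaw 2 y k) * ∑ l ∈ range (j + 1), r ^ l) H)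
    (n : ℕ) :
    |pulledAmp 2 y n - (pulledMeanBlock 2 y)⁻¹| ≤ H / (pulledMeanBlock 2 y * (1 - G)) * r⁻¹ ^ n :=
  abs_pulledAmp_sub_inv_le_of 1 (by linarith) (hasSum_pulledBlockLaw hy hL hLB hq)
    (summable_mul_pulledBlockLaw hy hL hLB hq) hr hG hG1 hH n

/-! ### Instances via the `2.688` condition -/

/-- **The pulled renewal gap under the gap condition, packaged**: relation ∧ finite mean ∧ all-`n` sandwich ∧ OZ
limit. [cite: Beaton2015, Lemma 2; MadrasSlade1993, Theorem 4.2.2 (b) and Appendix B, (B.5)] -/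
theorem pulledGap_of_gap {y L : ℝ} (hy : 1 ≤ y) (hL : 0 < L)
    (hLB : Real.log L ≤ pulledBridgeFreeEnergy 2 y) (hq : (2.688 : ℝ) ^ 3 * y < L ^ 3) :
    HasSum (pulledBlockLaw 2 y) 1 ∧ (Summable fun i : ℕ => (i : ℝ) * pulledBlockLaw 2 y i)
    ∧ (∀ n : ℕ, 2 - pulledMeanBlock 2 y ≤ pulledAmp 2 y n ∧ pulledAmp 2 y n ≤ 1)
    ∧ Tendsto (pulledAmp 2 y) atTop (𝓝 (pulledMeanBlock 2 y)⁻¹) :=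
  ⟨hasSum_pulledBlockLaw hy hL hLB hq, summable_mul_pulledBlockLaw hy hL hLB hq,
    two_sub_pulledMeanBlock_le_pulledAmp hy hL hLB hq, tendsto_pulledAmp hy hL hLB hq⟩

/-- **`y = 2`** (`L = 1250/351`, span-1 window `SAW.pulledBridgeZ_two_lower`: `38.8 < 45.2`).
[cite: Beaton2015, Lemma 2; MadrasSlade1993, Theorem 4.2.2 (b)] -/
theorem pulledGap_two :
    HasSum (pulledBlockLaw 2 (2 : ℝ)) 1 ∧ (Summable fun i : ℕ => (i : ℝ) * pulledBlockLaw 2 (2 : ℝ) i)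
    ∧ (∀ n : ℕ, 2 - pulledMeanBlock 2 2 ≤ pulledAmp 2 2 n ∧ pulledAmp 2 2 n ≤ 1)
    ∧ Tendsto (pulledAmp 2 (2 : ℝ)) atTop (𝓝 (pulledMeanBlock 2 2)⁻¹) :=
  pulledGap_of_gap (L := 1250 / 351) (by norm_num) (by norm_num)
    (log_le_pulledBridgeFreeEnergy_of_exists (by norm_num) (by norm_num) pulledBridgeZ_two_lower) (by norm_num)

/-- **`y = 125/64`** (`L = 10⁴/2850`: `37.9 < 43.2`). [cite: Beaton2015, Lemma 2; MadrasSlade1993, Theorem 4.2.2 (b)] -/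
theorem pulledGap_r125_64 :
    HasSum (pulledBlockLaw 2 ((125 : ℝ) / 64)) 1
    ∧ (Summable fun i : ℕ => (i : ℝ) * pulledBlockLaw 2 ((125 : ℝ) / 64) i)
    ∧ (∀ n : ℕ, 2 - pulledMeanBlock 2 ((125 : ℝ) / 64) ≤ pulledAmp 2 ((125 : ℝ) / 64) n
        ∧ pulledAmp 2 ((125 : ℝ) / 64) n ≤ 1)
    ∧ Tendsto (pulledAmp 2 ((125 : ℝ) / 64)) atTop (𝓝 (pulledMeanBlock 2 ((125 : ℝ) / 64))⁻¹) :=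
  pulledGap_of_gap (L := 10000 / 2850) (by norm_num) (by norm_num)
    (log_le_pulledBridgeFreeEnergy_of_exists (by norm_num) (by norm_num) pulledBridgeZ_r125_64_lower) (by norm_num)

/-! ### Rung `11/9`: the tilts `25/16` and `3/2` -/

/-- **Upper window at the rung `y' = 11/9`**: `λ_B(11/9) ≤ log(278379899/99000000)` (`e^{λ_B(11/9)} ≤ 2.8119182`;
`Z^B ≤ Z` and the `checkW_16_11_9` certificate). [cite: Beaton2015, Theorem 1; PonitzTittmann2000, §3] -/
theorem pulledBridgeFreeEnergy_elevenNinths_le :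
    pulledBridgeFreeEnergy 2 ((11 : ℝ) / 9) ≤ Real.log (278379899 / 99000000) :=
  pulledBridgeFreeEnergy_le_log_of_geometric 1 (y := (11 : ℝ) / 9) (C := 2 ^ 41) (by norm_num) (by norm_num)
    (by norm_num) fun N => (pulledBridgeZ_le_driftZ 2 N (by norm_num)).trans (driftZ_eleven_ninths_upper N)

/-- **The pulled renewal gap at `y = 25/16`** via the rung `11/9` (relation ∧ finite mean ∧ all-`n` sandwich ∧ OZ
limit; computational edition). [cite: Beaton2015, Lemma 2; MadrasSlade1993, Theorem 4.2.2 (b)] -/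
theorem pulledGap_r25_16 :
    HasSum (pulledBlockLaw 2 ((25 : ℝ) / 16)) 1
    ∧ (Summable fun i : ℕ => (i : ℝ) * pulledBlockLaw 2 ((25 : ℝ) / 16) i)
    ∧ (∀ n : ℕ, 2 - pulledMeanBlock 2 ((25 : ℝ) / 16) ≤ pulledAmp 2 ((25 : ℝ) / 16) n
        ∧ pulledAmp 2 ((25 : ℝ) / 16) n ≤ 1)
    ∧ Tendsto (pulledAmp 2 ((25 : ℝ) / 16)) atTop (𝓝 (pulledMeanBlock 2 ((25 : ℝ) / 16))⁻¹) :=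
  pulledGap_ladder (y' := (11 : ℝ) / 9) (L := 10000 / 3257) (U' := 278379899 / 99000000)
    (by norm_num) (by norm_num) (by norm_num) (by norm_num)
    (log_le_pulledBridgeFreeEnergy_of_exists (by norm_num) (by norm_num) pulledBridgeZ_twentyfive_sixteenths_lower)
    pulledBridgeFreeEnergy_elevenNinths_le (by norm_num)

/-- **The pulled renewal gap at `y = 3/2`** via the rung `11/9` and the strip-edition window `L = 10⁴/3251`
(relation ∧ finite mean ∧ all-`n` sandwich ∧ OZ limit; computational edition).
[cite: Beaton2015, Lemma 2; MadrasSlade1993, Theorem 4.2.2 (b)] -/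
theorem pulledGap_threeHalves :
    HasSum (pulledBlockLaw 2 ((3 : ℝ) / 2)) 1
    ∧ (Summable fun i : ℕ => (i : ℝ) * pulledBlockLaw 2 ((3 : ℝ) / 2) i)
    ∧ (∀ n : ℕ, 2 - pulledMeanBlock 2 ((3 : ℝ) / 2) ≤ pulledAmp 2 ((3 : ℝ) / 2) n
        ∧ pulledAmp 2 ((3 : ℝ) / 2) n ≤ 1)
    ∧ Tendsto (pulledAmp 2 ((3 : ℝ) / 2)) atTop (𝓝 (pulledMeanBlock 2 ((3 : ℝ) / 2))⁻¹) :=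
  pulledGap_ladder (y' := (11 : ℝ) / 9) (L := 10000 / 3251) (U' := 278379899 / 99000000)
    (by norm_num) (by norm_num) (by norm_num) (by norm_num)
    (log_le_pulledBridgeFreeEnergy_of_exists (by norm_num) (by norm_num) pulledBridgeZ_three_halves_lower_sharp)
    pulledBridgeFreeEnergy_elevenNinths_le (by norm_num)

end Literature.Probability.RandomPlanarGeometry.SAW.Zd
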